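import Summits.BirchSwinnertonDyer.BirchSwinnertonDyer.Theorems.PrintX11aMuCosetDoor
import Summits.BirchSwinnertonDyer.Rank1Residual.X11a.ChaRecords1
import HarnessLib

/-!
# Class X11a, NON-surjective leaf, HARD sub-locus (split at `p`, or `p ∣ ∏c·#Ш_an`): per-pair KERNEL
# μ-certificates through the Teichmüller-coset door — file 2 of 19: `51840l1`@5, `51840m1`@5
# (cell `bsd-print-x11a`, seat p3 g2; `--supports stmt-BirchSwinnertonDyer-20614 --as helper`)

HONEST FRAMING (cells `b2b-bsdres` / `bsd-print-x11a`, verbatim): the goal is to DELETE the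
COMBINATION-SHAPED residual classes of the Birch–Swinnerton-Dyer formula for ALL analytic-rank
`≤ 1` elliptic curves over `ℚ` — "full BSD formula for every rank `≤ 1` curve in class `C`"
assembled STRICTLY from published theorems — so that the rank-`≤ 1` remainder becomes exactly the
CONSTRUCTION-SHAPED classes, which are TYPED (missing-input `Prop`s), NOT attempted. This is not
"finishing BSD". PER PAIR (E1 currency): theorems only, no definition, no named fact; nothing is booked
by this file and no class label changes (referee / planner). The CLASS-level children
`UpperNonSurjFive` (item 20614) / `UpperNonSurjThree` (item 20613) of crux `X11aNonSurjEulerHalf` stay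
OPEN (Greenberg's μ-conjecture on the non-surjective X11a locus, barrier B3).

## What

For each pair below (the HARD sub-locus of the non-surjective X11a census: the unit-value door
`x11a_missingUpperBoundAt_of_not_surj_of_nonsplit_of_unit_value` does not apply), ty3's two-engine
μ-WITNESS record (`Literature/…/X11aPrintCertificates/RecordsLeafNonSurjMuPart1–2.lean`,
`RecordsThreeNonSurjMu.lean`: a level `n`, a Teichmüller coset `u·μ_{p−1} ⊂ (ℤ/pⁿ)^×` and the `p − 1`
plus modular symbols `x(a/pⁿ)` on it, `x = ϖ·[·]⁺_f` normalised by `x(0) = L(E,1)/Ω_E`, engines S = eclib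
and P = PARI twisted L-values, identical) is read IN THE KERNEL through p3's Teichmüller-coset door
(`Theorems/PrintX11aMuCosetCertificate.lean` + `PrintX11aMuCosetDoor.lean`): per pair

* `muAn<p>_m<label> : X11a.MuAnZeroAt W p` — for THE Mazur–Tate–Teitelbaum function of the reduction
  sign's kind SOME coefficient of `ϖ·L_p(E,T)` is a `p`-adic unit — from the DISPLAYED special value
  `L(E,1)/Ω_E` (`ht`) and the displayed `p − 1` symbol values (`hxs`), with the coset, the unit coset sum,
  `‖L(E,1)/Ω_E‖_p ≤ 1`, minimality, `Mult`, `Irr` decided in the KERNEL, modulo Mazur 1978 Cor. 4.1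
  (`hMz : mazur_not_dvd_maninConstant_of_odd`, `‖ϖ‖_p = 1`) — the per-pair instance of the registered stub
  `stub_muAnHard{Five,Three}` with NO assumed μ-claim;
* `mub<p>_m<label> : Typed.MissingUpperBoundAt W p` (crux-U currency) — `muAn` through the class-free
  rank-0 door `X11a.missingUpperBoundAt_of_muAnZeroAt_of_analyticRank_eq_zero[_of_nonsplit]` (K2
  μ-transfer without big image + rank-0 engine), modulo the TEN named facts of ty2's part 6 (+ Greenberg–
  Stevens at a split pair) and the displayed `r_an = 0`, image bit;
* `bsdp<p>_m<label> : BSDp W p` — with the displayed unit `#Ш_an` (lower half free) and GZK.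

Grammar of the kernel side = p4/p3's `X11a/ChaRecords*.lean` (Kraus minimality, `countPoints` Frobenius
witness, node-tangent non-split test, `integralModelInt`). beyond-print theorem: no.

References: [MazurTateTeitelbaum1986Invent] §I.10, §I.12–I.13; [Mazur1978] Cor. 4.1; [Kato2004Asterisque]
Thm. 12.4, §17.13; [Wuthrich2014] Cor. 18; [SteinWuthrich2013] Thm. 6.1, §3; [Miller2011LMS] Def. 1.1;
[SilvermanAEC2009] VII.1, VII.5.1; [Kraus1989]; [Cremona2006]; cell files HOME/TY3-CERTIFICATE-RECORDS.md §7,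
HOME/DOSSIER.md §26.2/§30, HOME/P3-EXCEPTIONAL-ZERO-ROAD.md §8.
-/

set_option autoImplicit false

noncomputable section

open scoped Classical MatrixGroups ModularForm

open CongruenceSubgroup WeierstrassCurve Literature.NumberTheory.EllipticCurves
  Literature.NumberTheory.EllipticCurves.ModularForms
  Literature.NumberTheory.EllipticCurves.Rank1Residual
  Literature.NumberTheory.EllipticCurves.Rank1Residual.Typed
  Literature.NumberTheory.EllipticCurves.Rank1Residual.X11RankOneCertificates
  Literature.NumberTheory.EllipticCurves.Wuthrich2014
  Literature.NumberTheory.EllipticCurves.SteinWuthrich2013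
  Literature.NumberTheory.EllipticCurves.Greenberg1999
  Literature.NumberTheory.EllipticCurves.Kato2004
  Summit.BirchSwinnertonDyer.BirchSwinnertonDyer.Rank1Residual.IntModel
  Summit.BirchSwinnertonDyer.BirchSwinnertonDyer.Rank1Residual.X11RankOne
  Summit.BirchSwinnertonDyer.Rank1Residual.Supersingular
  Summit.BirchSwinnertonDyer.Rank1Residual.X11b
  Summit.BirchSwinnertonDyer.Rank1Residual.X11a.ChaRecords

namespace Summit.BirchSwinnertonDyer.Rank1Residual.X11a.MuCosetRecords

/-! ### Teichmüller cosets used in this file (kernel decisions) -/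

/-- The Teichmüller coset of `(1+5)^1` modulo `5^2` (record level `2`, exponent `s₀ = 1`): the kernel decides
`b ∈ {6, 8, 17, 19} ↔ b^4 = 6^{4·1}` in `ℤ/25`. [folklore] -/
theorem coset_5_2_1 : ∀ b : ZMod (5 ^ (1 + 1)), b ∈ ({6, 8, 17, 19} : Finset (ZMod (5 ^ (1 + 1)))) ↔
    b ^ (5 - 1) = ((1 + 5 : ℕ) : ZMod (5 ^ (1 + 1))) ^ ((5 - 1) * (1 : ZMod (5 ^ 1)).val) := by
  decide +kernel

/-! ### `51840l1 @ 5` (`N = 51840`, image `5S4`, SPLIT multiplicative at `5`, `∏ c_ℓ = 10`, `#Ш_an = 1`, `L(E,1)/Ω_E = 10`;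
μ-witness (ty3 `RecordsLeafNonSurjMuPart1`, two engines): level `2`, `u = 6` (`s₀ = 1`), coset `{6, 8, 17, 19}` mod `25`, `x(6/25) = -7 / 2`, `x(8/25) = -5`, `x(17/25) = -5`, `x(19/25) = -7 / 2`, `Σ = -17`) -/

/-- `51840l1 = [0, 0, 0, -612, -8784]` is globally minimal: `|Δ| = 2¹³ · 3⁶ · 5⁵` (kernel) + Kraus.
[cite: SilvermanAEC2009, VII.1 Remark 1.1] [cite: Kraus1989, Prop. 1 and Prop. 2] -/
theorem isGloballyMinimal_m51840l1 : (⟨0, 0, 0, -612, -8784⟩ : WeierstrassCurve ℚ).IsGloballyMinimal :=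
  isGloballyMinimal_of_krausCriterion₃_factored 0 0 0 (-612) (-8784)
    [(2, 13), (3, 6), (5, 5)] (by decide +kernel)
    (by intro qe hqe; simp only [List.mem_cons, List.not_mem_nil, or_false] at hqe
        rcases hqe with rfl | rfl | rfl <;> norm_num)
    (by intro qe hqe; simp only [List.mem_cons, List.not_mem_nil, or_false] at hqe
        rcases hqe with rfl | rfl | rfl
        · exact Or.inr (Or.inr (Or.inl ⟨rfl, by decide +kernel, by decide +kernel⟩))
        · exact Or.inl (by decide +kernel)
        · exact Or.inl (by decide +kernel))

/-- `#Ẽ(𝔽_11) = 8` for `51840l1` (`a_11 = 4`; `X² − a_11X + 11` root-free mod `5`: the Frobenius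
irreducibility witness, kernel count `countPoints`). [folklore] -/
theorem card_m51840l1_11 :
    Nat.card (((⟨0, 0, 0, -612, -8784⟩ : WeierstrassCurve ℤ).map (Int.castRingHom (ZMod 11))).toAffine.Point) = 8 := by
  have h := X11b.natCard_point_eq_countPoints 0 0 0 (-612) (-8784) 11 (by norm_num) (by decide +kernel)
  have h' : countPoints [0, 0, 0, -612, -8784] 11 = 8 := by decide +kernel
  exact_mod_cast h.trans h'

/-- The coset sum of the μ-witness table of `51840l1 @ 5` is `-17` (kernel arithmetic on the displayed values). [folklore] -/
theorem sum_m51840l1 : (∑ b ∈ ({6, 8, 17, 19} : Finset (ZMod (5 ^ (1 + 1)))),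
    (fun b ↦ if b = 6 then -7 / 2 else if b = 8 then -5 else if b = 17 then -5 else if b = 19 then -7 / 2 else 0) b : ℚ) = (-17 : ℤ) / (1 : ℕ) := by
  decide +kernel

/-- **`μ^an(E,5) = 0` for `51840l1` IN THE KERNEL from the displayed coset table** (`X11a.MuAnZeroAt W 5`: some
coefficient of `ϖ·L_5(E,T)`, THE split Mazur–Tate–Teitelbaum function, is a `5`-adic unit) = the per-pair instance of
the registered stub `stub_muAnHardFive`. DISPLAYED: `L(E,1)/Ω_E = 10` (`ht`), the 4 symbols `x(6/25) = -7 / 2`, `x(8/25) = -5`, `x(17/25) = -5`, `x(19/25) = -7 / 2`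
(`hxs`, ty3's two-engine record; `x = ϖ·[·]⁺_f`, `x(0) = L(E,1)/Ω_E`). KERNEL: coset `{6, 8, 17, 19} = {b : b^4 = 6^{4·1}} ⊂ ℤ/25`
(`coset_5_2_1`), unit coset sum `-17` (`sum_m51840l1`), `Mult`, `Irr` (`card_m51840l1_11`). Modulo Mazur 1978 Cor. 4.1 (`hMz`).
PER PAIR; nothing booked. [cite: MazurTateTeitelbaum1986Invent, §I.10 and §I.12–I.13] [cite: Mazur1978, Cor. 4.1]
[cite: Cremona2006, Table 1 (Cremona label 51840l1)] -/
theorem muAn5_m51840l1 (hMz : mazur_not_dvd_maninConstant_of_odd)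
    (W : WeierstrassCurve ℚ) (hW : W = ⟨0, 0, 0, -612, -8784⟩)
    (ht : W.entireLFunction 1 / (W.realPeriodRat : ℂ) = ((10 : ℚ) : ℂ))
    (hxs : ∀ {N : ℕ} [NeZero N] (f : CuspForm (Gamma0 N) 2), IsNewformOf W f →
      ∀ (ϖ : ℚ), (ϖ : ℝ) * W.realPeriodRat = plusPeriod f →
        ϖ * ratPlusSymbol f (6 / 25) = -7 / 2 ∧
        ϖ * ratPlusSymbol f (8 / 25) = -5 ∧
        ϖ * ratPlusSymbol f (17 / 25) = -5 ∧
        ϖ * ratPlusSymbol f (19 / 25) = -7 / 2) :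
    ∀ [W.IsElliptic] [W.IsGloballyMinimal] [Fact (Nat.Prime 5)], X11a.MuAnZeroAt W 5 := by
  intro _ _ _ N _ f₁ hf₁ ϖ₁ hϖ₁
  have hI' : integralModelInt W = ⟨0, 0, 0, -612, -8784⟩ := by
    subst hW; exact integralModelInt_eq_of_map_eq _ (map_mk_int 0 0 0 (-612) (-8784))
  have hmult : Mult W 5 :=
    hasMultiplicativeReductionAtPrime_of_intModel hI' 5 (by decide +kernel) (by decide +kernel)
  haveI : Fact (Nat.Prime 11) := ⟨by norm_num⟩
  have hirr : Irr W 5 :=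
    hasIrreducibleModPGaloisRep_of_intModel_of_noroot (hp := ⟨by norm_num⟩) (hℓ := ⟨by norm_num⟩)
      hI' 5 11 (by norm_num) (by decide +kernel) card_m51840l1_11 (by decide)
  have hxs' : ∀ {N : ℕ} [NeZero N] (f : CuspForm (Gamma0 N) 2), IsNewformOf W f →
      ∀ (ϖ : ℚ), (ϖ : ℝ) * W.realPeriodRat = plusPeriod f →
        ∀ b ∈ ({6, 8, 17, 19} : Finset (ZMod (5 ^ (1 + 1)))),
          ϖ * ratPlusSymbol f ((b.val : ℚ) / (5 : ℚ) ^ (1 + 1)) = (fun b ↦ if b = 6 then -7 / 2 else if b = 8 then -5 else if b = 17 then -5 else if b = 19 then -7 / 2 else 0) b := by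
    intro N _ f hf ϖ hϖ b hb
    obtain ⟨h1, h2, h3, h4⟩ := hxs f hf ϖ hϖ
    simp only [Finset.mem_insert, Finset.mem_singleton] at hb
    rcases hb with rfl | rfl | rfl | rfl
    · rw [show (((6 : ZMod (5 ^ (1 + 1))).val : ℚ) / (5 : ℚ) ^ (1 + 1)) = 6 / 25 from by
        rw [show (6 : ZMod (5 ^ (1 + 1))).val = 6 from by decide +kernel]; norm_num, h1]
      decide +kernel
    · rw [show (((8 : ZMod (5 ^ (1 + 1))).val : ℚ) / (5 : ℚ) ^ (1 + 1)) = 8 / 25 from by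
        rw [show (8 : ZMod (5 ^ (1 + 1))).val = 8 from by decide +kernel]; norm_num, h2]
      decide +kernel
    · rw [show (((17 : ZMod (5 ^ (1 + 1))).val : ℚ) / (5 : ℚ) ^ (1 + 1)) = 17 / 25 from by
        rw [show (17 : ZMod (5 ^ (1 + 1))).val = 17 from by decide +kernel]; norm_num, h3]
      decide +kernel
    · rw [show (((19 : ZMod (5 ^ (1 + 1))).val : ℚ) / (5 : ℚ) ^ (1 + 1)) = 19 / 25 from by
        rw [show (19 : ZMod (5 ^ (1 + 1))).val = 19 from by decide +kernel]; norm_num, h4]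
      decide +kernel
  have hunit : ‖((∑ b ∈ ({6, 8, 17, 19} : Finset (ZMod (5 ^ (1 + 1)))), (fun b ↦ if b = 6 then -7 / 2 else if b = 8 then -5 else if b = 17 then -5 else if b = 19 then -7 / 2 else 0) b : ℚ) : ℚ_[5])‖ = 1 := by
    rw [sum_m51840l1]; exact MuCoset.norm_intCast_div_natCast_eq_one (by decide) (by decide)
  exact muAnZeroAt_of_cosetTable hMz (by decide) hmult hirr 10 ht (Padic.norm_rat_le_one (by decide))
    1 1 {6, 8, 17, 19} coset_5_2_1 (fun b ↦ if b = 6 then -7 / 2 else if b = 8 then -5 else if b = 17 then -5 else if b = 19 then -7 / 2 else 0) hxs' hunit f₁ hf₁ ϖ₁ hϖ₁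

/-- **`51840l1 @ 5`: the UPPER half `ord_5 #Ш ≤ ord_5 #Ш_an`** (`Typed.MissingUpperBoundAt W 5` = crux `X11aNonSurjEulerHalf` /
child `UpperNonSurjFive` AT THIS PAIR) from the kernel μ-certificate `muAn5_m51840l1` through
`X11a.missingUpperBoundAt_of_muAnZeroAt_of_analyticRank_eq_zero` (K2 μ-transfer without big image + rank-`0` engine):
modulo the TEN named facts of ty2's part 6 (SW13 Thm 6.1 ×2, GZK, modular parametrisation, Kato 12.4, Kato §17.13 ×3
[construction; flags `Kato-17.11-at-{nonsplit,split}-mult`, `Kato-p280-image-at-mult`], Greenberg 1.5, Wuthrich Cor 18),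
Greenberg–Stevens at the pair (`hGS`, split `p`), Mazur Cor 4.1; DISPLAYED `r_an = 0` (`hr`), image bit `¬Surj` (`hnsj`, `5S4`),
`ht`, `hxs`; KERNEL minimality, `Mult`, `Irr`. PER PAIR; nothing booked. [cite: Kato2004Asterisque, Thm. 12.4 (p. 221), §17.13 (pp. 279–280)]
[cite: Wuthrich2014, Cor. 18 (p. 398)] [cite: SteinWuthrich2013, Thm. 6.1 (p. 20)] [cite: Mazur1978, Cor. 4.1] [cite: Cremona2006, Table 1 (Cremona label 51840l1)] -/
theorem mub5_m51840l1
    (hJs : thm61_splitMultiplicative) (hJn : thm61_nonsplitMultiplicative)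
    (hGZK : rank_eq_analyticRank_of_analyticRank_le_one) (hpar : nonempty_modularParametrizationData)
    (h12 : Kato2004.thm12_4) (hns : Kato2004.exists_multDivisibilityInputs_nonsplit)
    (hsp : Kato2004.exists_multDivisibilityInputs_split) (h15 : thm15_isTorsion_multiplicative_rat)
    (h18 : Wuthrich2014.corollary18_padicLFunction_mem_iwasawaAlgebra_multiplicative)
    (hfine : Kato2004.exists_multDivisibilityInputs_fine) (hMz : mazur_not_dvd_maninConstant_of_odd)
    (W : WeierstrassCurve ℚ) (hW : W = ⟨0, 0, 0, -612, -8784⟩)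
    (hGS : ∀ [W.IsElliptic] [W.IsGloballyMinimal] [Fact (Nat.Prime 5)], greenberg_stevens (W := W) (p := 5))
    (hr : W.analyticRank = 0) (hnsj : ∀ [Fact (Nat.Prime 5)], ¬ Surj W 5)
    (ht : W.entireLFunction 1 / (W.realPeriodRat : ℂ) = ((10 : ℚ) : ℂ))
    (hxs : ∀ {N : ℕ} [NeZero N] (f : CuspForm (Gamma0 N) 2), IsNewformOf W f →
      ∀ (ϖ : ℚ), (ϖ : ℝ) * W.realPeriodRat = plusPeriod f →
        ϖ * ratPlusSymbol f (6 / 25) = -7 / 2 ∧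
        ϖ * ratPlusSymbol f (8 / 25) = -5 ∧
        ϖ * ratPlusSymbol f (17 / 25) = -5 ∧
        ϖ * ratPlusSymbol f (19 / 25) = -7 / 2) :
    MissingUpperBoundAt W 5 := by
  haveI : W.IsElliptic := by rw [hW]; exact X11b.isElliptic_of_discOf_ne_zero 0 0 0 (-612) (-8784) (by decide +kernel)
  haveI : W.IsGloballyMinimal := by rw [hW]; exact isGloballyMinimal_m51840l1
  haveI : Fact (Nat.Prime 5) := ⟨by norm_num⟩
  have hI' : integralModelInt W = ⟨0, 0, 0, -612, -8784⟩ := by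
    subst hW; exact integralModelInt_eq_of_map_eq _ (map_mk_int 0 0 0 (-612) (-8784))
  have hmult : Mult W 5 :=
    hasMultiplicativeReductionAtPrime_of_intModel hI' 5 (by decide +kernel) (by decide +kernel)
  haveI : Fact (Nat.Prime 11) := ⟨by norm_num⟩
  have hirr : Irr W 5 :=
    hasIrreducibleModPGaloisRep_of_intModel_of_noroot (hp := ⟨by norm_num⟩) (hℓ := ⟨by norm_num⟩)
      hI' 5 11 (by norm_num) (by decide +kernel) card_m51840l1_11 (by decide)
  exact missingUpperBoundAt_of_muAnZeroAt_of_analyticRank_eq_zero W 5 hJs hJn hGZK hpar h12 hns hsp h15 h18 hfine hGS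
    (by decide) hr hmult hirr hnsj (muAn5_m51840l1 hMz W hW ht hxs)

/-- **`BSD(E,5)` for `51840l1`** (`#Ш_an = 1`, a `5`-adic unit, displayed as `hq`/`hv`, so the lower half is free): the upper
half `mub5_m51840l1` + GZK. PER PAIR (E1 currency); modulo the ten facts + GS + Mazur + the displayed data; nothing booked;
the class-wide children U5/U3 stay open. [cite: Miller2011LMS, §1 and Def. 1.1] [cite: Cremona2006, Table 1 (Cremona label 51840l1)] -/
theorem bsdp5_m51840l1
    (hJs : thm61_splitMultiplicative) (hJn : thm61_nonsplitMultiplicative)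
    (hGZK : rank_eq_analyticRank_of_analyticRank_le_one) (hpar : nonempty_modularParametrizationData)
    (h12 : Kato2004.thm12_4) (hns : Kato2004.exists_multDivisibilityInputs_nonsplit)
    (hsp : Kato2004.exists_multDivisibilityInputs_split) (h15 : thm15_isTorsion_multiplicative_rat)
    (h18 : Wuthrich2014.corollary18_padicLFunction_mem_iwasawaAlgebra_multiplicative)
    (hfine : Kato2004.exists_multDivisibilityInputs_fine) (hMz : mazur_not_dvd_maninConstant_of_odd)
    (W : WeierstrassCurve ℚ) (hW : W = ⟨0, 0, 0, -612, -8784⟩)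
    (hGS : ∀ [W.IsElliptic] [W.IsGloballyMinimal] [Fact (Nat.Prime 5)], greenberg_stevens (W := W) (p := 5))
    (hr : W.analyticRank = 0) (hnsj : ∀ [Fact (Nat.Prime 5)], ¬ Surj W 5)
    (ht : W.entireLFunction 1 / (W.realPeriodRat : ℂ) = ((10 : ℚ) : ℂ))
    (hxs : ∀ {N : ℕ} [NeZero N] (f : CuspForm (Gamma0 N) 2), IsNewformOf W f →
      ∀ (ϖ : ℚ), (ϖ : ℝ) * W.realPeriodRat = plusPeriod f →
        ϖ * ratPlusSymbol f (6 / 25) = -7 / 2 ∧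
        ϖ * ratPlusSymbol f (8 / 25) = -5 ∧
        ϖ * ratPlusSymbol f (17 / 25) = -5 ∧
        ϖ * ratPlusSymbol f (19 / 25) = -7 / 2)
    {q : ℚ} (hq : shaAn W = (q : ℂ)) (hv : padicValRat 5 q = 0) : BSDp W 5 := by
  haveI : W.IsElliptic := by rw [hW]; exact X11b.isElliptic_of_discOf_ne_zero 0 0 0 (-612) (-8784) (by decide +kernel)
  haveI : Fact (Nat.Prime 5) := ⟨by norm_num⟩
  exact bsdp_of_upper_of_unit_of_analyticRank_eq_zero W 5 hGZK hr
    (mub5_m51840l1 hJs hJn hGZK hpar h12 hns hsp h15 h18 hfine hMz W hW hGS hr hnsj ht hxs) hq hv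

/-! ### `51840m1 @ 5` (`N = 51840`, image `5S4`, SPLIT multiplicative at `5`, `∏ c_ℓ = 5`, `#Ш_an = 1`, `L(E,1)/Ω_E = 5`;
μ-witness (ty3 `RecordsLeafNonSurjMuPart1`, two engines): level `2`, `u = 6` (`s₀ = 1`), coset `{6, 8, 17, 19}` mod `25`, `x(6/25) = 3 / 2`, `x(8/25) = -11 / 2`, `x(17/25) = -11 / 2`, `x(19/25) = 3 / 2`, `Σ = -8`) -/

/-- `51840m1 = [0, 0, 0, -1377, -29646]` is globally minimal: `|Δ| = 2⁷ · 3¹² · 5⁵` (kernel) + Kraus.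
[cite: SilvermanAEC2009, VII.1 Remark 1.1] [cite: Kraus1989, Prop. 1 and Prop. 2] -/
theorem isGloballyMinimal_m51840m1 : (⟨0, 0, 0, -1377, -29646⟩ : WeierstrassCurve ℚ).IsGloballyMinimal :=
  isGloballyMinimal_of_krausCriterion₃_factored 0 0 0 (-1377) (-29646)
    [(2, 7), (3, 12), (5, 5)] (by decide +kernel)
    (by intro qe hqe; simp only [List.mem_cons, List.not_mem_nil, or_false] at hqe
        rcases hqe with rfl | rfl | rfl <;> norm_num)
    (by intro qe hqe; simp only [List.mem_cons, List.not_mem_nil, or_false] at hqe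
        rcases hqe with rfl | rfl | rfl
        · exact Or.inl (by decide +kernel)
        · exact Or.inr (Or.inr (Or.inr (Or.inr (Or.inr (Or.inr ⟨rfl, by decide +kernel, by decide +kernel⟩)))))
        · exact Or.inl (by decide +kernel))

/-- `#Ẽ(𝔽_11) = 16` for `51840m1` (`a_11 = -4`; `X² − a_11X + 11` root-free mod `5`: the Frobenius
irreducibility witness, kernel count `countPoints`). [folklore] -/
theorem card_m51840m1_11 :
    Nat.card (((⟨0, 0, 0, -1377, -29646⟩ : WeierstrassCurve ℤ).map (Int.castRingHom (ZMod 11))).toAffine.Point) = 16 := by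
  have h := X11b.natCard_point_eq_countPoints 0 0 0 (-1377) (-29646) 11 (by norm_num) (by decide +kernel)
  have h' : countPoints [0, 0, 0, -1377, -29646] 11 = 16 := by decide +kernel
  exact_mod_cast h.trans h'

/-- The coset sum of the μ-witness table of `51840m1 @ 5` is `-8` (kernel arithmetic on the displayed values). [folklore] -/
theorem sum_m51840m1 : (∑ b ∈ ({6, 8, 17, 19} : Finset (ZMod (5 ^ (1 + 1)))),
    (fun b ↦ if b = 6 then 3 / 2 else if b = 8 then -11 / 2 else if b = 17 then -11 / 2 else if b = 19 then 3 / 2 else 0) b : ℚ) = (-8 : ℤ) / (1 : ℕ) := by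
  decide +kernel

/-- **`μ^an(E,5) = 0` for `51840m1` IN THE KERNEL from the displayed coset table** (`X11a.MuAnZeroAt W 5`: some
coefficient of `ϖ·L_5(E,T)`, THE split Mazur–Tate–Teitelbaum function, is a `5`-adic unit) = the per-pair instance of
the registered stub `stub_muAnHardFive`. DISPLAYED: `L(E,1)/Ω_E = 5` (`ht`), the 4 symbols `x(6/25) = 3 / 2`, `x(8/25) = -11 / 2`, `x(17/25) = -11 / 2`, `x(19/25) = 3 / 2`
(`hxs`, ty3's two-engine record; `x = ϖ·[·]⁺_f`, `x(0) = L(E,1)/Ω_E`). KERNEL: coset `{6, 8, 17, 19} = {b : b^4 = 6^{4·1}} ⊂ ℤ/25`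
(`coset_5_2_1`), unit coset sum `-8` (`sum_m51840m1`), `Mult`, `Irr` (`card_m51840m1_11`). Modulo Mazur 1978 Cor. 4.1 (`hMz`).
PER PAIR; nothing booked. [cite: MazurTateTeitelbaum1986Invent, §I.10 and §I.12–I.13] [cite: Mazur1978, Cor. 4.1]
[cite: Cremona2006, Table 1 (Cremona label 51840m1)] -/
theorem muAn5_m51840m1 (hMz : mazur_not_dvd_maninConstant_of_odd)
    (W : WeierstrassCurve ℚ) (hW : W = ⟨0, 0, 0, -1377, -29646⟩)
    (ht : W.entireLFunction 1 / (W.realPeriodRat : ℂ) = ((5 : ℚ) : ℂ))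
    (hxs : ∀ {N : ℕ} [NeZero N] (f : CuspForm (Gamma0 N) 2), IsNewformOf W f →
      ∀ (ϖ : ℚ), (ϖ : ℝ) * W.realPeriodRat = plusPeriod f →
        ϖ * ratPlusSymbol f (6 / 25) = 3 / 2 ∧
        ϖ * ratPlusSymbol f (8 / 25) = -11 / 2 ∧
        ϖ * ratPlusSymbol f (17 / 25) = -11 / 2 ∧
        ϖ * ratPlusSymbol f (19 / 25) = 3 / 2) :
    ∀ [W.IsElliptic] [W.IsGloballyMinimal] [Fact (Nat.Prime 5)], X11a.MuAnZeroAt W 5 := by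
  intro _ _ _ N _ f₁ hf₁ ϖ₁ hϖ₁
  have hI' : integralModelInt W = ⟨0, 0, 0, -1377, -29646⟩ := by
    subst hW; exact integralModelInt_eq_of_map_eq _ (map_mk_int 0 0 0 (-1377) (-29646))
  have hmult : Mult W 5 :=
    hasMultiplicativeReductionAtPrime_of_intModel hI' 5 (by decide +kernel) (by decide +kernel)
  haveI : Fact (Nat.Prime 11) := ⟨by norm_num⟩
  have hirr : Irr W 5 :=
    hasIrreducibleModPGaloisRep_of_intModel_of_noroot (hp := ⟨by norm_num⟩) (hℓ := ⟨by norm_num⟩)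
      hI' 5 11 (by norm_num) (by decide +kernel) card_m51840m1_11 (by decide)
  have hxs' : ∀ {N : ℕ} [NeZero N] (f : CuspForm (Gamma0 N) 2), IsNewformOf W f →
      ∀ (ϖ : ℚ), (ϖ : ℝ) * W.realPeriodRat = plusPeriod f →
        ∀ b ∈ ({6, 8, 17, 19} : Finset (ZMod (5 ^ (1 + 1)))),
          ϖ * ratPlusSymbol f ((b.val : ℚ) / (5 : ℚ) ^ (1 + 1)) = (fun b ↦ if b = 6 then 3 / 2 else if b = 8 then -11 / 2 else if b = 17 then -11 / 2 else if b = 19 then 3 / 2 else 0) b := by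
    intro N _ f hf ϖ hϖ b hb
    obtain ⟨h1, h2, h3, h4⟩ := hxs f hf ϖ hϖ
    simp only [Finset.mem_insert, Finset.mem_singleton] at hb
    rcases hb with rfl | rfl | rfl | rfl
    · rw [show (((6 : ZMod (5 ^ (1 + 1))).val : ℚ) / (5 : ℚ) ^ (1 + 1)) = 6 / 25 from by
        rw [show (6 : ZMod (5 ^ (1 + 1))).val = 6 from by decide +kernel]; norm_num, h1]
      decide +kernel
    · rw [show (((8 : ZMod (5 ^ (1 + 1))).val : ℚ) / (5 : ℚ) ^ (1 + 1)) = 8 / 25 from by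
        rw [show (8 : ZMod (5 ^ (1 + 1))).val = 8 from by decide +kernel]; norm_num, h2]
      decide +kernel
    · rw [show (((17 : ZMod (5 ^ (1 + 1))).val : ℚ) / (5 : ℚ) ^ (1 + 1)) = 17 / 25 from by
        rw [show (17 : ZMod (5 ^ (1 + 1))).val = 17 from by decide +kernel]; norm_num, h3]
      decide +kernel
    · rw [show (((19 : ZMod (5 ^ (1 + 1))).val : ℚ) / (5 : ℚ) ^ (1 + 1)) = 19 / 25 from by
        rw [show (19 : ZMod (5 ^ (1 + 1))).val = 19 from by decide +kernel]; norm_num, h4]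
      decide +kernel
  have hunit : ‖((∑ b ∈ ({6, 8, 17, 19} : Finset (ZMod (5 ^ (1 + 1)))), (fun b ↦ if b = 6 then 3 / 2 else if b = 8 then -11 / 2 else if b = 17 then -11 / 2 else if b = 19 then 3 / 2 else 0) b : ℚ) : ℚ_[5])‖ = 1 := by
    rw [sum_m51840m1]; exact MuCoset.norm_intCast_div_natCast_eq_one (by decide) (by decide)
  exact muAnZeroAt_of_cosetTable hMz (by decide) hmult hirr 5 ht (Padic.norm_rat_le_one (by decide))
    1 1 {6, 8, 17, 19} coset_5_2_1 (fun b ↦ if b = 6 then 3 / 2 else if b = 8 then -11 / 2 else if b = 17 then -11 / 2 else if b = 19 then 3 / 2 else 0) hxs' hunit f₁ hf₁ ϖ₁ hϖ₁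

/-- **`51840m1 @ 5`: the UPPER half `ord_5 #Ш ≤ ord_5 #Ш_an`** (`Typed.MissingUpperBoundAt W 5` = crux `X11aNonSurjEulerHalf` /
child `UpperNonSurjFive` AT THIS PAIR) from the kernel μ-certificate `muAn5_m51840m1` through
`X11a.missingUpperBoundAt_of_muAnZeroAt_of_analyticRank_eq_zero` (K2 μ-transfer without big image + rank-`0` engine):
modulo the TEN named facts of ty2's part 6 (SW13 Thm 6.1 ×2, GZK, modular parametrisation, Kato 12.4, Kato §17.13 ×3
[construction; flags `Kato-17.11-at-{nonsplit,split}-mult`, `Kato-p280-image-at-mult`], Greenberg 1.5, Wuthrich Cor 18),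
Greenberg–Stevens at the pair (`hGS`, split `p`), Mazur Cor 4.1; DISPLAYED `r_an = 0` (`hr`), image bit `¬Surj` (`hnsj`, `5S4`),
`ht`, `hxs`; KERNEL minimality, `Mult`, `Irr`. PER PAIR; nothing booked. [cite: Kato2004Asterisque, Thm. 12.4 (p. 221), §17.13 (pp. 279–280)]
[cite: Wuthrich2014, Cor. 18 (p. 398)] [cite: SteinWuthrich2013, Thm. 6.1 (p. 20)] [cite: Mazur1978, Cor. 4.1] [cite: Cremona2006, Table 1 (Cremona label 51840m1)] -/
theorem mub5_m51840m1
    (hJs : thm61_splitMultiplicative) (hJn : thm61_nonsplitMultiplicative)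
    (hGZK : rank_eq_analyticRank_of_analyticRank_le_one) (hpar : nonempty_modularParametrizationData)
    (h12 : Kato2004.thm12_4) (hns : Kato2004.exists_multDivisibilityInputs_nonsplit)
    (hsp : Kato2004.exists_multDivisibilityInputs_split) (h15 : thm15_isTorsion_multiplicative_rat)
    (h18 : Wuthrich2014.corollary18_padicLFunction_mem_iwasawaAlgebra_multiplicative)
    (hfine : Kato2004.exists_multDivisibilityInputs_fine) (hMz : mazur_not_dvd_maninConstant_of_odd)
    (W : WeierstrassCurve ℚ) (hW : W = ⟨0, 0, 0, -1377, -29646⟩)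
    (hGS : ∀ [W.IsElliptic] [W.IsGloballyMinimal] [Fact (Nat.Prime 5)], greenberg_stevens (W := W) (p := 5))
    (hr : W.analyticRank = 0) (hnsj : ∀ [Fact (Nat.Prime 5)], ¬ Surj W 5)
    (ht : W.entireLFunction 1 / (W.realPeriodRat : ℂ) = ((5 : ℚ) : ℂ))
    (hxs : ∀ {N : ℕ} [NeZero N] (f : CuspForm (Gamma0 N) 2), IsNewformOf W f →
      ∀ (ϖ : ℚ), (ϖ : ℝ) * W.realPeriodRat = plusPeriod f →
        ϖ * ratPlusSymbol f (6 / 25) = 3 / 2 ∧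
        ϖ * ratPlusSymbol f (8 / 25) = -11 / 2 ∧
        ϖ * ratPlusSymbol f (17 / 25) = -11 / 2 ∧
        ϖ * ratPlusSymbol f (19 / 25) = 3 / 2) :
    MissingUpperBoundAt W 5 := by
  haveI : W.IsElliptic := by rw [hW]; exact X11b.isElliptic_of_discOf_ne_zero 0 0 0 (-1377) (-29646) (by decide +kernel)
  haveI : W.IsGloballyMinimal := by rw [hW]; exact isGloballyMinimal_m51840m1
  haveI : Fact (Nat.Prime 5) := ⟨by norm_num⟩
  have hI' : integralModelInt W = ⟨0, 0, 0, -1377, -29646⟩ := by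
    subst hW; exact integralModelInt_eq_of_map_eq _ (map_mk_int 0 0 0 (-1377) (-29646))
  have hmult : Mult W 5 :=
    hasMultiplicativeReductionAtPrime_of_intModel hI' 5 (by decide +kernel) (by decide +kernel)
  haveI : Fact (Nat.Prime 11) := ⟨by norm_num⟩
  have hirr : Irr W 5 :=
    hasIrreducibleModPGaloisRep_of_intModel_of_noroot (hp := ⟨by norm_num⟩) (hℓ := ⟨by norm_num⟩)
      hI' 5 11 (by norm_num) (by decide +kernel) card_m51840m1_11 (by decide)
  exact missingUpperBoundAt_of_muAnZeroAt_of_analyticRank_eq_zero W 5 hJs hJn hGZK hpar h12 hns hsp h15 h18 hfine hGS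
    (by decide) hr hmult hirr hnsj (muAn5_m51840m1 hMz W hW ht hxs)

/-- **`BSD(E,5)` for `51840m1`** (`#Ш_an = 1`, a `5`-adic unit, displayed as `hq`/`hv`, so the lower half is free): the upper
half `mub5_m51840m1` + GZK. PER PAIR (E1 currency); modulo the ten facts + GS + Mazur + the displayed data; nothing booked;
the class-wide children U5/U3 stay open. [cite: Miller2011LMS, §1 and Def. 1.1] [cite: Cremona2006, Table 1 (Cremona label 51840m1)] -/
theorem bsdp5_m51840m1
    (hJs : thm61_splitMultiplicative) (hJn : thm61_nonsplitMultiplicative)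
    (hGZK : rank_eq_analyticRank_of_analyticRank_le_one) (hpar : nonempty_modularParametrizationData)
    (h12 : Kato2004.thm12_4) (hns : Kato2004.exists_multDivisibilityInputs_nonsplit)
    (hsp : Kato2004.exists_multDivisibilityInputs_split) (h15 : thm15_isTorsion_multiplicative_rat)
    (h18 : Wuthrich2014.corollary18_padicLFunction_mem_iwasawaAlgebra_multiplicative)
    (hfine : Kato2004.exists_multDivisibilityInputs_fine) (hMz : mazur_not_dvd_maninConstant_of_odd)
    (W : WeierstrassCurve ℚ) (hW : W = ⟨0, 0, 0, -1377, -29646⟩)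
    (hGS : ∀ [W.IsElliptic] [W.IsGloballyMinimal] [Fact (Nat.Prime 5)], greenberg_stevens (W := W) (p := 5))
    (hr : W.analyticRank = 0) (hnsj : ∀ [Fact (Nat.Prime 5)], ¬ Surj W 5)
    (ht : W.entireLFunction 1 / (W.realPeriodRat : ℂ) = ((5 : ℚ) : ℂ))
    (hxs : ∀ {N : ℕ} [NeZero N] (f : CuspForm (Gamma0 N) 2), IsNewformOf W f →
      ∀ (ϖ : ℚ), (ϖ : ℝ) * W.realPeriodRat = plusPeriod f →
        ϖ * ratPlusSymbol f (6 / 25) = 3 / 2 ∧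
        ϖ * ratPlusSymbol f (8 / 25) = -11 / 2 ∧
        ϖ * ratPlusSymbol f (17 / 25) = -11 / 2 ∧
        ϖ * ratPlusSymbol f (19 / 25) = 3 / 2)
    {q : ℚ} (hq : shaAn W = (q : ℂ)) (hv : padicValRat 5 q = 0) : BSDp W 5 := by
  haveI : W.IsElliptic := by rw [hW]; exact X11b.isElliptic_of_discOf_ne_zero 0 0 0 (-1377) (-29646) (by decide +kernel)
  haveI : Fact (Nat.Prime 5) := ⟨by norm_num⟩
  exact bsdp_of_upper_of_unit_of_analyticRank_eq_zero W 5 hGZK hr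
    (mub5_m51840m1 hJs hJn hGZK hpar h12 hns hsp h15 h18 hfine hMz W hW hGS hr hnsj ht hxs) hq hv

end Summit.BirchSwinnertonDyer.Rank1Residual.X11a.MuCosetRecords

end
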